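import Mathlib
import Summits.NavierStokesRegularity.NavierStokesRegularity.Theorems.BarrierStepRungThreeWindowBoxReduction
import Literature.MathematicalPhysics.QuantumFieldTheory.Balaban1983to89.B9Eq343PlateauProfile
import HarnessLib

/-!
# Two-function form of the window certificate: TUBE `h` + CLOCK `w` (route `BarrierStepRungThree`, K2″)

GLUE-E″ (supports item stmt-NavierStokesRegularity-23648 `WindowCertificateMargin`, repaired format). The
box certificate `WindowBox.taoLadderRungThree_target_of_boxCertificateSplit₃` asks for ONE `C¹` function
`v` that is simultaneously the REGION (`{v ≤ 0}`: properness, datum, goal re-entry) and the CLOCK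
(undisturbed decrease `≤ -(γ+δ)`, floor `> -γc`). A sum-of-squares search for such a `v` is bilinear
(the S-procedure multiplier of `-v` multiplies the unknown `v`); the numerically natural object is a
PAIR: a fixed TUBE function `h` (region `{h ≤ 0}`, found first) and a CLOCK `w` (linear search given
`h`). This file turns a two-function certificate into the one-function one, with

  `v x := w x + C · max (h x) 0 ^ 2`   (`C ≥ 0`; `C¹`, equal to `w` on the tube, `≥ w + C h²` outside).

Inside the tube (`h ≤ 0`) `v = w` and `fderiv v = fderiv w`; on the COLLAR (`0 ≤ h`, `w + C h² ≤ 0`)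
`v = w + C h²` and `fderiv v = fderiv w + 2 C h · fderiv h`, so an INFLOW condition `fderiv h (F) ≤ 0`
on the collar keeps the decrease. Every hypothesis about `(w, h)` below is a polynomial implication on a
basic semialgebraic set when `w, h, g` are polynomials — i.e. ONE S-procedure / Putinar identity each,
LINEAR in the multipliers once `w, h` are fixed (`SProc.*`, file `BarrierStepRungThreeSProcedureKit.lean`).

Main result: `WindowBox.taoLadderRungThree_target_of_twoFunctionCertificate₃` — the hypotheses of the
box certificate with every `v`-clause replaced by its tube/collar pair for `(w, h, C)` imply
`TaoLadderRungThree.Target`. Calculus: the tree's `hasDerivAt_posPart_sq` (`s ↦ max s 0 ^ 2` has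
derivative `2 max s 0`; `Literature/…/B9Eq343PlateauProfile.lean`), `WindowBox.contDiff_maxSq` (it is `C¹`),
`WindowBox.hasFDerivAt_tubeClock`.

HONEST FRAMING: plumbing about Tao-type MODEL lattice pseudo-flows (class rung TL-M3); no certificate is
produced here (the pair `(w, h)` for SOME comparable table is the line's open ∃-crux); nothing here is a
statement about the Navier–Stokes equations, and NS regularity is not proved by any of this.
-/

noncomputable section

-- the sub-problem namespace `Summit.NavierStokesRegularity.NavierStokesRegularity` repeats the summit name by design (D-0017)
set_option linter.dupNamespace false

namespace Summit.NavierStokesRegularity.NavierStokesRegularity.Theorems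

namespace WindowBox

open Literature.Analysis.FluidPDE Literature.Analysis.FluidPDE.TaoCascade Filter Topology
open Literature.MathematicalPhysics.QuantumFieldTheory.Balaban1983to89.B9Eq343PlateauProfile (hasDerivAt_posPart_sq)

/-! ### The `C¹` ramp `s ↦ max s 0 ^ 2` -/

/-- The ramp `s ↦ max s 0 ^ 2` is `C¹`. [folklore] -/
theorem contDiff_maxSq : ContDiff ℝ 1 (fun t : ℝ => max t 0 ^ 2) := by
  have hderiv : deriv (fun t : ℝ => max t 0 ^ 2) = fun s => 2 * max s 0 :=
    funext fun s => (hasDerivAt_posPart_sq s).deriv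
  rw [show (1 : WithTop ℕ∞) = 0 + 1 from rfl, contDiff_succ_iff_deriv]
  refine ⟨fun s => (hasDerivAt_posPart_sq s).differentiableAt, by simp, ?_⟩
  rw [hderiv]
  exact contDiff_zero.2 (by fun_prop)

/-! ### The combined function `v = w + C · max h 0 ^ 2` -/

variable {n : ℕ}

/-- `v := w + C · max h 0 ^ 2` is `C¹` when `w, h` are. [folklore] -/
theorem contDiff_tubeClock {w h : (Fin 4 → Fin n → ℝ) → ℝ} (hw : ContDiff ℝ 1 w)
    (hh : ContDiff ℝ 1 h) (C : ℝ) :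
    ContDiff ℝ 1 (fun x => w x + C * max (h x) 0 ^ 2) :=
  hw.add (contDiff_const.mul (contDiff_maxSq.comp hh))

/-- Fréchet derivative of `v := w + C · max h 0 ^ 2`:
`fderiv v x = fderiv w x + (C · 2 · max (h x) 0) • fderiv h x`. [folklore] -/
theorem hasFDerivAt_tubeClock {w h : (Fin 4 → Fin n → ℝ) → ℝ} (hw : ContDiff ℝ 1 w)
    (hh : ContDiff ℝ 1 h) (C : ℝ) (x : Fin 4 → Fin n → ℝ) :
    HasFDerivAt (fun x => w x + C * max (h x) 0 ^ 2)
      (fderiv ℝ w x + (C * (2 * max (h x) 0)) • fderiv ℝ h x) x := by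
  have hw' : HasFDerivAt w (fderiv ℝ w x) x := (hw.differentiable one_ne_zero x).hasFDerivAt
  have hh' : HasFDerivAt h (fderiv ℝ h x) x := (hh.differentiable one_ne_zero x).hasFDerivAt
  have hcomp : HasFDerivAt (fun x => max (h x) 0 ^ 2) ((2 * max (h x) 0) • fderiv ℝ h x) x :=
    (hasDerivAt_posPart_sq (h x)).comp_hasFDerivAt x hh'
  have hmul := hcomp.const_mul C
  rw [smul_smul] at hmul
  exact hw'.add hmul

/-- On the tube `{h ≤ 0}`: `v = w`. [folklore] -/
theorem tubeClock_apply_of_nonpos {w h : (Fin 4 → Fin n → ℝ) → ℝ} {C : ℝ}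
    {x : Fin 4 → Fin n → ℝ} (hx : h x ≤ 0) : w x + C * max (h x) 0 ^ 2 = w x := by
  rw [max_eq_right hx]; ring

/-- Off the tube (`0 ≤ h`): `v = w + C h²`. [folklore] -/
theorem tubeClock_apply_of_nonneg {w h : (Fin 4 → Fin n → ℝ) → ℝ} {C : ℝ}
    {x : Fin 4 → Fin n → ℝ} (hx : 0 ≤ h x) : w x + C * max (h x) 0 ^ 2 = w x + C * h x ^ 2 := by
  rw [max_eq_left hx]

/-- **Rung TL-M3 from a TWO-FUNCTION (tube + clock) box certificate in the repaired format K2″.**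
Data as in `taoLadderRungThree_target_of_boxCertificateSplit₃` except that the single `C¹` function
`v` is replaced by a TUBE function `h`, a CLOCK `w` (both `C¹` on `ℝ^{4n}`) and a constant `C ≥ 0`;
every `v`-clause is replaced by a pair of implications — on the TUBE `{w ≤ 0, h ≤ 0}` and on the
COLLAR `{0 ≤ h, w + C h² ≤ 0}`: properness, clock floor, operator-norm bound (`‖fderiv w‖ ≤ Λ`,
resp. `‖fderiv w‖ + 2Ch‖fderiv h‖ ≤ Λ`), undisturbed decrease of `w` on the box `≤ -(γ+δ)`, INFLOW of
the tube on the collar (`fderiv h (quadTerm|window) ≤ 0`), goal (threshold, and `w ≤ 0`, `h ≤ 0`,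
`g > 0` at the shifted rescaled state); datum: `w ≤ 0`, `h ≤ 0`. Then `TaoLadderRungThree.Target`,
by the box certificate for `v := w + C · max h 0 ^ 2`. For polynomial `w, h, g` every hypothesis is a
polynomial implication on a basic semialgebraic set — one S-procedure/Putinar identity, LINEAR in its
multipliers once `w, h` are fixed. [cite: PrajnaRantzer2007, Thm 3.5 and §3.4 (barrier + eventuality
certificates; two-function form); Tao2016AveragedNS §6.4 Prop. 6.5] -/
theorem taoLadderRungThree_target_of_twoFunctionCertificate₃ {kLo : ℤ} {R θ c η γ Λ δ C : ℝ}
    {i₀ : Fin 4} {α : Fin 4 → Fin 4 → Fin 4 → ℤ × ℤ × ℤ → ℝ} {X₀ : Fin 4 → ℝ}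
    {w h g : (Fin 4 → Fin n → ℝ) → ℝ} {r q ρ env Ψ : ℤ → ℝ} {Mw Φ : Fin 4 → Fin n → ℝ}
    (B : ℤ → ℝ)
    (hR : 1 ≤ R) (hα : InTableClass R α) (hX₀ : X₀ i₀ ≠ 0) (hθ0 : 0 ≤ θ) (hθ : θ ≤ 1 / 2)
    (hc : 0 < c) (hη : 0 < η) (hγ : 0 < γ) (hkLo : kLo ≤ 0) (hkn : (2 : ℤ) ≤ kLo + n)
    (hw : ContDiff ℝ 1 w) (hh : ContDiff ℝ 1 h) (hC : 0 ≤ C) (hg : Continuous g)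
    (hΨ : ∀ (L' : ℕ) (k : ℤ), slackWeight 1 θ c env L' k ≤ Ψ k)
    (hprof : ∀ k : ℤ, 0 ≤ r k ∧ r k < q k ∧ 0 ≤ ρ k ∧ r k + c * ρ k ≤ q k ∧ q k ^ 2 / 2 ≤ env k)
    (hup : ∀ k : ℤ, kLo + n ≤ k → (1 + 1 : ℝ) ^ ((5 : ℝ) * ((k - 1 : ℤ) : ℝ) / 2) *
      (∑ i₁ : Fin 4, ∑ i₂ : Fin 4, ∑ i₃ : Fin 4, |α i₁ i₂ i₃ (0, 0, 1)|) * q (k - 1) ^ 2 ≤ ρ k)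
    (hΦq : ∀ (i : Fin 4) (j : Fin n), (j : ℕ) + 1 = n → 2 * Φ i j ≤ q (kLo + (j : ℕ)) ^ 2)
    (hdecay : ∀ k : ℤ, kLo + n ≤ k → q (k + 1) ≤ (1 + 1 : ℝ) ^ (-θ) * r k)
    (hΦ : ∀ (i : Fin 4) (j : Fin n), 0 ≤ Φ i j ∧ Φ i j ≤ env (kLo + (j : ℕ)) ∧
      Mw i j ^ 2 / 2 + η * Ψ (kLo + (j : ℕ)) +
        η * (1 + 1 : ℝ) ^ ((2 : ℝ) * ((kLo + (j : ℕ) : ℤ) : ℝ)) * c * Φ i j < Φ i j)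
    (hM₁ : ∃ M₁ : ℝ, ∀ k : ℤ, kLo + n ≤ k → (1 + (1 + 1 : ℝ) ^ ((10 : ℝ) * (k : ℝ))) * q k ≤ M₁)
    (hw0 : w (fun i (j : Fin n) => datumState i₀ X₀ i (kLo + (j : ℕ))) ≤ 0)
    (hh0 : h (fun i (j : Fin n) => datumState i₀ X₀ i (kLo + (j : ℕ))) ≤ 0)
    (hg0 : 0 < g (fun i (j : Fin n) => datumState i₀ X₀ i (kLo + (j : ℕ))))
    (hproper_in : ∀ x : Fin 4 → Fin n → ℝ, w x ≤ 0 → h x ≤ 0 → ∀ i j, |x i j| ≤ Mw i j)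
    (hproper_col : ∀ x : Fin 4 → Fin n → ℝ, 0 ≤ h x → w x + C * h x ^ 2 ≤ 0 → ∀ i j, |x i j| ≤ Mw i j)
    (hfloor_in : ∀ x : Fin 4 → Fin n → ℝ, w x ≤ 0 → h x ≤ 0 → 0 < g x → -(γ * c) < w x)
    (hfloor_col : ∀ x : Fin 4 → Fin n → ℝ, 0 ≤ h x → w x + C * h x ^ 2 ≤ 0 → 0 < g x →
      -(γ * c) < w x + C * h x ^ 2)
    (hdec_in : ∀ S : Fin 4 → ℤ → ℝ, w (fun i (j : Fin n) => S i (kLo + (j : ℕ))) ≤ 0 →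
      h (fun i (j : Fin n) => S i (kLo + (j : ℕ))) ≤ 0 →
      (∀ (i : Fin 4) (k : ℤ), (k < kLo ∨ kLo + n ≤ k) → |S i k| ≤ q k) →
      (∀ (i : Fin 4) (j : Fin n), S i (kLo + (j : ℕ)) ^ 2 ≤ 2 * Φ i j) →
      0 < g (fun i (j : Fin n) => S i (kLo + (j : ℕ))) →
      (fderiv ℝ w (fun i (j : Fin n) => S i (kLo + (j : ℕ))))
        (fun i (j : Fin n) => quadTerm 1 α (fun i' k' (_ : ℝ) => S i' k') i (kLo + (j : ℕ)) 0) ≤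
        -(γ + δ))
    (hdec_col : ∀ S : Fin 4 → ℤ → ℝ, 0 ≤ h (fun i (j : Fin n) => S i (kLo + (j : ℕ))) →
      w (fun i (j : Fin n) => S i (kLo + (j : ℕ))) +
        C * h (fun i (j : Fin n) => S i (kLo + (j : ℕ))) ^ 2 ≤ 0 →
      (∀ (i : Fin 4) (k : ℤ), (k < kLo ∨ kLo + n ≤ k) → |S i k| ≤ q k) →
      (∀ (i : Fin 4) (j : Fin n), S i (kLo + (j : ℕ)) ^ 2 ≤ 2 * Φ i j) →
      0 < g (fun i (j : Fin n) => S i (kLo + (j : ℕ))) →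
      (fderiv ℝ w (fun i (j : Fin n) => S i (kLo + (j : ℕ))))
        (fun i (j : Fin n) => quadTerm 1 α (fun i' k' (_ : ℝ) => S i' k') i (kLo + (j : ℕ)) 0) ≤
        -(γ + δ))
    (hinflow : ∀ S : Fin 4 → ℤ → ℝ, 0 ≤ h (fun i (j : Fin n) => S i (kLo + (j : ℕ))) →
      w (fun i (j : Fin n) => S i (kLo + (j : ℕ))) +
        C * h (fun i (j : Fin n) => S i (kLo + (j : ℕ))) ^ 2 ≤ 0 →
      (∀ (i : Fin 4) (k : ℤ), (k < kLo ∨ kLo + n ≤ k) → |S i k| ≤ q k) →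
      (∀ (i : Fin 4) (j : Fin n), S i (kLo + (j : ℕ)) ^ 2 ≤ 2 * Φ i j) →
      0 < g (fun i (j : Fin n) => S i (kLo + (j : ℕ))) →
      (fderiv ℝ h (fun i (j : Fin n) => S i (kLo + (j : ℕ))))
        (fun i (j : Fin n) => quadTerm 1 α (fun i' k' (_ : ℝ) => S i' k') i (kLo + (j : ℕ)) 0) ≤ 0)
    (hΛ_in : ∀ x : Fin 4 → Fin n → ℝ, w x ≤ 0 → h x ≤ 0 → ‖fderiv ℝ w x‖ ≤ Λ)
    (hΛ_col : ∀ x : Fin 4 → Fin n → ℝ, 0 ≤ h x → w x + C * h x ^ 2 ≤ 0 →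
      ‖fderiv ℝ w x‖ + 2 * C * h x * ‖fderiv ℝ h x‖ ≤ Λ)
    (hΛ0 : 0 ≤ Λ)
    (hbudget : ∀ (i : Fin 4) (j : Fin n),
      Λ * (η * (1 + 1 : ℝ) ^ ((2 : ℝ) * ((kLo + (j : ℕ) : ℤ) : ℝ)) * Real.sqrt (Φ i j)) ≤ δ)
    (hBout : ∀ k, k < kLo → q k ≤ B k)
    (hBwin : ∀ (i : Fin 4) (j : Fin n), (j : ℕ) = 0 → 2 * Φ i j ≤ B kLo ^ 2) (hB0 : 0 ≤ B kLo)
    (htail : ∀ k : ℤ, k < kLo →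
      16 * ((1 + 1 : ℝ) ^ ((5 : ℝ) * (k : ℝ) / 2) * (B k * B k + 2 * (B k * B (k + 1))) +
        (1 + 1 : ℝ) ^ ((5 : ℝ) * ((k - 1 : ℤ) : ℝ) / 2) * (B (k - 1) * B (k - 1))) ≤ ρ k)
    (hgoal_in : ∀ S : Fin 4 → ℤ → ℝ, w (fun i (j : Fin n) => S i (kLo + (j : ℕ))) ≤ 0 →
      h (fun i (j : Fin n) => S i (kLo + (j : ℕ))) ≤ 0 →
      (∀ (i : Fin 4) (k : ℤ), (k < kLo ∨ kLo + n ≤ k) → |S i k| ≤ q k) →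
      (∀ (i : Fin 4) (j : Fin n), S i (kLo + (j : ℕ)) ^ 2 ≤ 2 * Φ i j) →
      g (fun i (j : Fin n) => S i (kLo + (j : ℕ))) ≤ 0 →
      (1 + 1 : ℝ) ^ (-θ) ≤ |S i₀ 1| ∧
        w (fun i (j : Fin n) => S i (1 + (kLo + (j : ℕ))) / |S i₀ 1|) ≤ 0 ∧
        h (fun i (j : Fin n) => S i (1 + (kLo + (j : ℕ))) / |S i₀ 1|) ≤ 0 ∧
        0 < g (fun i (j : Fin n) => S i (1 + (kLo + (j : ℕ))) / |S i₀ 1|))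
    (hgoal_col : ∀ S : Fin 4 → ℤ → ℝ, 0 ≤ h (fun i (j : Fin n) => S i (kLo + (j : ℕ))) →
      w (fun i (j : Fin n) => S i (kLo + (j : ℕ))) +
        C * h (fun i (j : Fin n) => S i (kLo + (j : ℕ))) ^ 2 ≤ 0 →
      (∀ (i : Fin 4) (k : ℤ), (k < kLo ∨ kLo + n ≤ k) → |S i k| ≤ q k) →
      (∀ (i : Fin 4) (j : Fin n), S i (kLo + (j : ℕ)) ^ 2 ≤ 2 * Φ i j) →
      g (fun i (j : Fin n) => S i (kLo + (j : ℕ))) ≤ 0 →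
      (1 + 1 : ℝ) ^ (-θ) ≤ |S i₀ 1| ∧
        w (fun i (j : Fin n) => S i (1 + (kLo + (j : ℕ))) / |S i₀ 1|) ≤ 0 ∧
        h (fun i (j : Fin n) => S i (1 + (kLo + (j : ℕ))) / |S i₀ 1|) ≤ 0 ∧
        0 < g (fun i (j : Fin n) => S i (1 + (kLo + (j : ℕ))) / |S i₀ 1|))
    (hgoalq : ∀ k : ℤ, k + 1 < kLo → q (k + 1) ≤ (1 + 1 : ℝ) ^ (-θ) * r k)
    (hgoalΦ : ∀ (i : Fin 4) (j : Fin n), (j : ℕ) = 0 →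
      2 * Φ i j ≤ ((1 + 1 : ℝ) ^ (-θ) * r (kLo - 1)) ^ 2) :
    Summit.NavierStokesRegularity.NavierStokesRegularity.Theses.TaoLadderRungThree.Target := by
  -- the combined region/clock function
  have key : ∀ x : Fin 4 → Fin n → ℝ, w x + C * max (h x) 0 ^ 2 ≤ 0 →
      (h x ≤ 0 ∧ w x ≤ 0) ∨ (0 ≤ h x ∧ w x + C * h x ^ 2 ≤ 0) := by
    intro x hvx
    rcases le_or_gt (h x) 0 with hx | hx
    · left
      refine ⟨hx, ?_⟩
      rwa [tubeClock_apply_of_nonpos hx] at hvx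
    · right
      refine ⟨hx.le, ?_⟩
      rwa [tubeClock_apply_of_nonneg hx.le] at hvx
  have hfd : ∀ x : Fin 4 → Fin n → ℝ, fderiv ℝ (fun x => w x + C * max (h x) 0 ^ 2) x =
      fderiv ℝ w x + (C * (2 * max (h x) 0)) • fderiv ℝ h x :=
    fun x => (hasFDerivAt_tubeClock hw hh C x).fderiv
  have happ : ∀ x d : Fin 4 → Fin n → ℝ, (fderiv ℝ (fun x => w x + C * max (h x) 0 ^ 2) x) d =
      fderiv ℝ w x d + C * (2 * max (h x) 0) * fderiv ℝ h x d := by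
    intro x d; rw [hfd]; rfl
  refine taoLadderRungThree_target_of_boxCertificateSplit₃ (kLo := kLo)
    (v := fun x => w x + C * max (h x) 0 ^ 2) B hR hα hX₀ hθ0 hθ hc hη hγ hkLo hkn
    (contDiff_tubeClock hw hh C) hg hΨ hprof hup hΦq hdecay hΦ hM₁ ?_ hg0 ?_ ?_ ?_ ?_ hΛ0 hbudget
    hBout hBwin hB0 htail ?_ hgoalq hgoalΦ
  · -- datum
    show w _ + C * max (h _) 0 ^ 2 ≤ 0
    rw [tubeClock_apply_of_nonpos hh0]; exact hw0
  · -- properness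
    intro x hvx i j
    rcases key x hvx with ⟨h1, h2⟩ | ⟨h1, h2⟩
    · exact hproper_in x h2 h1 i j
    · exact hproper_col x h1 h2 i j
  · -- floor
    intro x hvx hgx
    rcases key x hvx with ⟨h1, h2⟩ | ⟨h1, h2⟩
    · show -(γ * c) < w x + C * max (h x) 0 ^ 2
      rw [tubeClock_apply_of_nonpos h1]; exact hfloor_in x h2 h1 hgx
    · show -(γ * c) < w x + C * max (h x) 0 ^ 2
      rw [tubeClock_apply_of_nonneg h1]; exact hfloor_col x h1 h2 hgx
  · -- undisturbed decrease on the box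
    intro S hvS hb1 hb2 hgS
    rw [happ]
    rcases key _ hvS with ⟨h1, h2⟩ | ⟨h1, h2⟩
    · rw [max_eq_right h1, mul_zero, mul_zero, zero_mul, add_zero]
      exact hdec_in S h2 h1 hb1 hb2 hgS
    · rw [max_eq_left h1]
      have hd := hdec_col S h1 h2 hb1 hb2 hgS
      have hi := hinflow S h1 h2 hb1 hb2 hgS
      have hprod : C * (2 * h (fun i (j : Fin n) => S i (kLo + (j : ℕ)))) *
          (fderiv ℝ h (fun i (j : Fin n) => S i (kLo + (j : ℕ))))
            (fun i (j : Fin n) => quadTerm 1 α (fun i' k' (_ : ℝ) => S i' k') i (kLo + (j : ℕ)) 0)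
          ≤ 0 :=
        mul_nonpos_of_nonneg_of_nonpos (by positivity) hi
      linarith
  · -- operator-norm bound on the region
    intro x hvx
    rw [hfd]
    rcases key x hvx with ⟨h1, h2⟩ | ⟨h1, h2⟩
    · rw [max_eq_right h1, mul_zero, mul_zero, zero_smul, add_zero]
      exact hΛ_in x h2 h1
    · rw [max_eq_left h1]
      calc ‖fderiv ℝ w x + (C * (2 * h x)) • fderiv ℝ h x‖
          ≤ ‖fderiv ℝ w x‖ + ‖(C * (2 * h x)) • fderiv ℝ h x‖ := norm_add_le _ _
        _ = ‖fderiv ℝ w x‖ + 2 * C * h x * ‖fderiv ℝ h x‖ := by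
            rw [norm_smul, Real.norm_eq_abs, abs_of_nonneg (by positivity)]; ring
        _ ≤ Λ := hΛ_col x h1 h2
  · -- goal on the box
    intro S hvS hb1 hb2 hgS
    rcases key _ hvS with ⟨h1, h2⟩ | ⟨h1, h2⟩
    · obtain ⟨ha, hw', hh', hg'⟩ := hgoal_in S h2 h1 hb1 hb2 hgS
      refine ⟨ha, ?_, hg'⟩
      show w _ + C * max (h _) 0 ^ 2 ≤ 0
      rw [tubeClock_apply_of_nonpos hh']; exact hw'
    · obtain ⟨ha, hw', hh', hg'⟩ := hgoal_col S h1 h2 hb1 hb2 hgS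
      refine ⟨ha, ?_, hg'⟩
      show w _ + C * max (h _) 0 ^ 2 ≤ 0
      rw [tubeClock_apply_of_nonpos hh']; exact hw'

end WindowBox

end Summit.NavierStokesRegularity.NavierStokesRegularity.Theorems

end
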